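import Mathlib
import Summits.PneNP.PneNP.Theses.LatticeMagic
import Literature.Algebra.EuclideanLattices.DualLattice
import Literature.Algebra.EuclideanLattices.QaryLatticeDuality
import Summits.PneNP.PneNP.Theorems.LatticeMagicMagicFunctionsPersistStubPersistence
import Summits.PneNP.PneNP.Theorems.LatticeMagicMagicFunctionsPersistStubRowLatticeEuc
import Summits.PneNP.PneNP.Theorems.LatticeMagicMagicFunctionsPersistStubFirstMoment
import Summits.PneNP.PneNP.Theorems.LatticeMagicMagicFunctionsPersistStubCount
import Summits.PneNP.PneNP.Theorems.LatticeMagicMagicFunctionsPersistStubVolume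
import Summits.PneNP.PneNP.Theorems.LatticeMagicMagicFunctionsPersistStubParams
import Summits.PneNP.PneNP.Theorems.LatticeMagicMagicFunctionsPersistStubHalfPointDepth
import HarnessLib

/-!
# `MagicFunctionsPersist` (route LatticeMagic, item stmt-PneNP-2328) — line `Sketch`
(q-ary first-moment spine), composition of the seven landed stub files
`LatticeMagicMagicFunctionsPersistStub{Persistence,RowLatticeEuc,FirstMoment,Count,Volume,Params,HalfPointDepth}.lean`

The crux AS TYPED asks for a full-rank lattice `L ⊆ ℝⁿ`, a point `t` and a radius `d` with
`d < dist(t,L) ≤ 2d` (we take `γ₀ = 1`), BLINDNESS `λ₁(L*) ≥ 2√n/d`, and PERSISTENCE: a uniform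
dual cosine sum `f = ∑_{j<N} cos 2π⟪w_j, ·⟫` with `f(t) < Nθ ≤ f` on the `d`-tube around `L`.

Spine (refuter 4766edce's half-point observation + the Rogers–Loeliger first moment of the crux
idea card `rogers-qary-first-moment`):

* `stub_persistence` — at a HALF-LATTICE point `t = v/2` (`v ∈ L`, `t ∉ L`) persistence is free:
  a `ℤ`-basis `w₁,…,wₙ` of `L*` with all `⟪w_j, v⟫` odd gives `f(t) = -n`, the global minimum of
  `f`, attained exactly on `t + L`, which the closed `d`-tube misses (compactness).
* hence (half-point reduction, Step 2 of `MagicFunctionsPersist_of`) the crux follows from ONE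
  lattice family with `λ₁(L*) · dist(v/2, L) > 2√n` at a half-lattice point;
* the family: `L = Λ_q(Aᵀ) ⊇ qℤⁿ` (`rowLattice A`, tree) for a prime `q ∈ (n, 2n]` and a matrix
  `A ∈ (ℤ/q)^{(n/2) × n}` such that neither `Λ_q^⊥(A)` nor `Λ_q(Aᵀ)` has a nonzero vector of norm
  `< r`, `r² = 5q√n` (`stub_firstMoment`: union bound over the finitely many short integer
  vectors, `stub_count` + `stub_volume` + `stub_params`: there are fewer than `q^{n/2}/2` of them);
  then `L* ⊆ q⁻¹Λ_q^⊥(A)` (`stub_rowLatticeEuc`) gives `λ₁(L*) ≥ r/q`, and the canonical half point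
  `t = (q/2)e₀` has `dist(t, L) ≥ λ₁(L)/2 ≥ r/2` (`stub_halfPointDepth`), so
  `λ₁(L*)·dist ≥ r²/(2q) = 2.5√n > 2√n`.

HONEST SCOPE: this closes the item as filed; it does not touch the intended
positivity-vs-certification question (see the route docstring's CAVEAT and the evidence note
analysis-typed-vs-intended.md on the item).
-/

set_option linter.dupNamespace false -- `Summit.PneNP.PneNP.…`: summit = sub-problem (D-0017)

noncomputable section

open scoped BigOperators InnerProductSpace
open MeasureTheory Literature.Algebra.EuclideanLattices

namespace Summit.PneNP.PneNP.Theorems.LatticeMagicMagicFunctionsPersist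

/-! ## Composition -/

/-- A nonzero integer vector of Euclidean norm `< r ≤ q` (`r ≥ 0`) is nonzero mod `q`. -/
theorem modQ_ne_zero_of_sum_sq_lt {n q : ℕ} {r : ℝ} (hr0 : 0 ≤ r) (hrq : r ≤ q) {z : Fin n → ℤ}
    (hz : z ≠ 0) (hzr : ∑ i, ((z i : ℤ) : ℝ) ^ 2 < r ^ 2) : modQ q z ≠ 0 := by
  intro hmod
  obtain ⟨i, hi⟩ : ∃ i, z i ≠ 0 := by
    by_contra h
    push Not at h
    exact hz (funext h)
  have hdvd : (q : ℤ) ∣ z i := by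
    have := congrFun hmod i
    simp only [modQ_apply, Pi.zero_apply] at this
    exact (ZMod.intCast_zmod_eq_zero_iff_dvd _ _).1 this
  have hqle : (q : ℤ) ≤ |z i| := by
    obtain ⟨c, hc⟩ := hdvd
    have hc0 : c ≠ 0 := by rintro rfl; simp [hc] at hi
    rw [hc, abs_mul]
    calc (q : ℤ) = |(q : ℤ)| * 1 := by simp
      _ ≤ |(q : ℤ)| * |c| := by gcongr; exact Int.one_le_abs hc0
  have hqle' : (q : ℝ) ≤ |((z i : ℤ) : ℝ)| := by
    have : ((q : ℤ) : ℝ) ≤ ((|z i| : ℤ) : ℝ) := by exact_mod_cast hqle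
    rwa [Int.cast_abs, Int.cast_natCast] at this
  have hsq : (q : ℝ) ^ 2 ≤ ((z i : ℤ) : ℝ) ^ 2 := by
    rw [← sq_abs ((z i : ℤ) : ℝ)]
    exact pow_le_pow_left₀ (Nat.cast_nonneg q) hqle' 2
  have hle : ((z i : ℤ) : ℝ) ^ 2 ≤ ∑ j, ((z j : ℤ) : ℝ) ^ 2 :=
    Finset.single_le_sum (f := fun j => ((z j : ℤ) : ℝ) ^ 2) (fun j _ => sq_nonneg _)
      (Finset.mem_univ i)
  have : r ^ 2 ≤ (q : ℝ) ^ 2 := pow_le_pow_left₀ hr0 hrq 2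
  linarith

/-- A nonzero integer vector of norm `< r ≤ q` lies in the finite list of such vectors taken
inside the box `[-q, q]ⁿ`. -/
theorem mem_shortVectors {n q : ℕ} {r : ℝ} (hr0 : 0 ≤ r) (hrq : r ≤ q) {z : Fin n → ℤ}
    (hz : z ≠ 0) (hzr : ∑ i, ((z i : ℤ) : ℝ) ^ 2 < r ^ 2) :
    z ∈ (Fintype.piFinset fun _ : Fin n => Finset.Icc (-(q : ℤ)) q).filter
      fun z => z ≠ 0 ∧ ∑ i, ((z i : ℤ) : ℝ) ^ 2 < r ^ 2 := by
  refine Finset.mem_filter.2 ⟨Fintype.mem_piFinset.2 fun i => Finset.mem_Icc.2 ?_, hz, hzr⟩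
  have hle : ((z i : ℤ) : ℝ) ^ 2 ≤ ∑ j, ((z j : ℤ) : ℝ) ^ 2 :=
    Finset.single_le_sum (f := fun j => ((z j : ℤ) : ℝ) ^ 2) (fun j _ => sq_nonneg _)
      (Finset.mem_univ i)
  have h1 : ((z i : ℤ) : ℝ) ^ 2 ≤ (q : ℝ) ^ 2 := by
    have : r ^ 2 ≤ (q : ℝ) ^ 2 := pow_le_pow_left₀ hr0 hrq 2
    linarith
  have h2 : |((z i : ℤ) : ℝ)| ≤ (q : ℝ) := by
    have h := sq_le_sq.1 h1
    rwa [abs_of_nonneg (show (0 : ℝ) ≤ (q : ℝ) by positivity)] at h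
  have h3 : |z i| ≤ (q : ℤ) := by
    rw [← Int.cast_abs] at h2
    exact_mod_cast h2
  exact abs_le.1 h3

/-- **Composition.** The stubs imply the crux `MagicFunctionsPersist` as typed.
Step 1 (`key`, the q-ary family): in every dimension `n = 2m`, `m ≥ max(2^18, n₀)`, there are a
full-rank lattice `L = Λ_q(Aᵀ) ⊆ ℝⁿ`, a lattice vector `v = q e₀` and the bound `Λ = r/q` below all
nonzero dual norms with `2√n < Λ · dist(v/2, L)`.
Step 2 (half-point reduction, refuter 4766edce's observation, via `stub_persistence`): this gives
`MagicFunctionsPersist` with `γ₀ = 1`, `C = 1`, `t = v/2`, `N = n` and `d = max(dist/2, 2√n/Λ)`. -/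
theorem MagicFunctionsPersist_of :
    Summit.PneNP.PneNP.Theses.LatticeMagic.MagicFunctionsPersist := by
  have key : ∀ n₀ : ℕ, ∃ (n : ℕ) (L : Submodule ℤ (EuclideanSpace ℝ (Fin n)))
      (_ : DiscreteTopology L) (_ : IsZLattice ℝ L) (v : EuclideanSpace ℝ (Fin n)) (Λ : ℝ),
      n₀ ≤ n ∧ 0 < n ∧ v ∈ L ∧ 0 < Λ ∧ (∀ w ∈ dualLattice L, w ≠ 0 → Λ ≤ ‖w‖) ∧
      2 * Real.sqrt n < Λ * Metric.infDist ((1 / 2 : ℝ) • v) (L : Set (EuclideanSpace ℝ (Fin n))) := by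
    intro n₀
    -- dimension `n = 2m`, `m ≥ max(2^18, n₀)`
    set m : ℕ := max (2 ^ 18) n₀ with hm
    have hm18 : 2 ^ 18 ≤ m := le_max_left _ _
    have hm0 : 0 < m := lt_of_lt_of_le (by norm_num) hm18
    set n : ℕ := 2 * m with hn
    have hn0 : 0 < n := by omega
    have hn₀ : n₀ ≤ n := by
      have : n₀ ≤ m := le_max_right _ _
      omega
    -- a prime `q` with `n < q ≤ 2n`; it is odd
    obtain ⟨q, hqprime, hnq, hq2n⟩ := Nat.exists_prime_lt_and_le_two_mul n hn0.ne'
    haveI : Fact q.Prime := ⟨hqprime⟩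
    have hqodd : Odd q := hqprime.odd_of_ne_two (by omega)
    have hq0 : (0 : ℝ) < q := by exact_mod_cast hqprime.pos
    have hnq' : (n : ℝ) ≤ q := by exact_mod_cast hnq.le
    -- the radius `r`, `r² = 5 q √n`
    set r : ℝ := Real.sqrt (5 * q * Real.sqrt n) with hr
    have hsqrt : 0 < Real.sqrt n := Real.sqrt_pos.2 (by exact_mod_cast hn0)
    have hr0 : 0 < r := Real.sqrt_pos.2 (by positivity)
    have hr2 : r ^ 2 = 5 * q * Real.sqrt n := Real.sq_sqrt (by positivity)
    obtain ⟨hrq, h4, hcount⟩ := stub_params hm18 hn hnq' hr0 hr2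
    -- the short nonzero integer vectors
    set S : Finset (Fin n → ℤ) := (Fintype.piFinset fun _ : Fin n => Finset.Icc (-(q : ℤ)) q).filter
      fun z => z ≠ 0 ∧ ∑ i, ((z i : ℤ) : ℝ) ^ 2 < r ^ 2 with hS
    have hSmod : ∀ z ∈ S, modQ q z ≠ 0 := fun z hz => by
      obtain ⟨-, hz0, hzr⟩ := Finset.mem_filter.1 hz
      exact modQ_ne_zero_of_sum_sq_lt hr0.le hrq hz0 hzr
    have hScard : (S.card : ℝ) ≤ (1 + Real.sqrt n / r) ^ n *
        (Real.pi * Real.exp 1 * r ^ 2 / m) ^ m := by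
      refine (stub_count hn0 hr0 S fun z hz => (Finset.mem_filter.1 hz).2.2.le).trans ?_
      gcongr
      exact stub_volume hm0 hr0.le
    -- the first moment
    have hcard : (S.card : ℝ) / (q : ℝ) ^ m + (S.card : ℝ) * (q : ℝ) ^ m / (q : ℝ) ^ n < 1 := by
      have hqm : (0 : ℝ) < (q : ℝ) ^ m := by positivity
      have e1 : (q : ℝ) ^ n = (q : ℝ) ^ m * (q : ℝ) ^ m := by rw [← pow_add, hn, two_mul]
      rw [e1, mul_div_mul_right _ _ hqm.ne', ← add_div, div_lt_one hqm]
      linarith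
    obtain ⟨A, hAperp, hArow⟩ := stub_firstMoment hm0 hn0 S S hSmod hSmod hcard
    -- no short vectors in `Λ_q^⊥(A)` and `Λ_q(Aᵀ)`
    have hnorm : ∀ z : Fin n → ℤ, ‖intToEuc (Fin n) z‖ ^ 2 = ∑ i, ((z i : ℤ) : ℝ) ^ 2 := fun z => by
      rw [EuclideanSpace.real_norm_sq_eq]
      simp [intToEuc_apply]
    have hshort : ∀ z : Fin n → ℤ, z ≠ 0 → ‖intToEuc (Fin n) z‖ < r → z ∈ S := fun z hz hzr => by
      refine mem_shortVectors hr0.le hrq hz ?_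
      rw [← hnorm]
      exact pow_lt_pow_left₀ hzr (norm_nonneg _) two_ne_zero
    have hperp : ∀ x ∈ perpLattice A, x ≠ 0 → r ≤ ‖intToEuc (Fin n) x‖ := fun x hx hx0 => by
      by_contra h
      push Not at h
      exact hAperp x (hshort x hx0 h) hx
    have hrow : ∀ y ∈ rowLattice A, y ≠ 0 → r ≤ ‖intToEuc (Fin n) y‖ := fun y hy hy0 => by
      by_contra h
      push Not at h
      exact hArow y (hshort y hy0 h) hy
    -- the lattice `L = Λ_q(Aᵀ) ⊆ ℝⁿ`, the half point `t = (q/2) e₀`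
    haveI : NeZero q := ⟨hqprime.ne_zero⟩
    obtain ⟨hLd, hLz, hLdual⟩ := stub_rowLatticeEuc A
    set L : Submodule ℤ (EuclideanSpace ℝ (Fin n)) := (rowLattice A).map (intToEuc (Fin n)) with hL
    have i₀ : Fin n := ⟨0, hn0⟩
    set v : EuclideanSpace ℝ (Fin n) := intToEuc (Fin n) ((q : ℤ) • Pi.single i₀ 1) with hv
    have hvL : v ∈ L := Submodule.mem_map.2 ⟨_, qsmul_mem_rowLattice A _, rfl⟩
    have hdepth := stub_halfPointDepth hqodd A i₀ hrow
    refine ⟨n, L, hLd, hLz, v, r / q, hn₀, hn0, hvL, by positivity, fun w hw hw0 => ?_, ?_⟩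
    · obtain ⟨x, hx, hxw⟩ := hLdual w hw
      have hx0 : x ≠ 0 := by
        rintro rfl
        apply hw0
        have : (q : ℝ) • w = 0 := by rw [← hxw, map_zero]
        exact (smul_eq_zero.1 this).resolve_left hq0.ne'
      have h1 := hperp x hx hx0
      rw [hxw, norm_smul, Real.norm_natCast] at h1
      rw [div_le_iff₀ hq0, mul_comm]
      exact h1
    · calc 2 * Real.sqrt n = (4 * q * Real.sqrt n) / (2 * q) := by field_simp; ring
        _ < r ^ 2 / (2 * q) := by gcongr
        _ = r / q * (r / 2) := by ring
        _ ≤ r / q * Metric.infDist ((1 / 2 : ℝ) • v) (L : Set (EuclideanSpace ℝ (Fin n))) := by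
          gcongr
  -- Step 2: the half-point reduction
  unfold Summit.PneNP.PneNP.Theses.LatticeMagic.MagicFunctionsPersist
  refine ⟨1, le_rfl, 1, fun n₀ => ?_⟩
  obtain ⟨n, L, hLd, hLz, v, Λ, hn₀, hn, hv, hΛ, hdual, hP⟩ := key n₀
  set t : EuclideanSpace ℝ (Fin n) := (1 / 2 : ℝ) • v with ht
  set D : ℝ := Metric.infDist t (L : Set (EuclideanSpace ℝ (Fin n))) with hD
  have hsqrt : 0 < Real.sqrt n := Real.sqrt_pos.2 (by exact_mod_cast hn)
  have hD0 : 0 < D := by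
    by_contra hD0
    push Not at hD0
    have : Λ * D ≤ 0 := mul_nonpos_of_nonneg_of_nonpos hΛ.le hD0
    linarith
  set d : ℝ := max (D / 2) (2 * Real.sqrt n / Λ) with hd
  have hd0 : 0 < d := lt_max_of_lt_left (by positivity)
  have hdD : d < D := by
    refine max_lt (by linarith) ?_
    rw [div_lt_iff₀ hΛ]
    linarith [mul_comm Λ D]
  have hD2d : D ≤ 2 * d := by
    have : D / 2 ≤ d := le_max_left _ _
    linarith
  obtain ⟨w, hw, θ, hθt, hθx⟩ := stub_persistence hn L hv hd0.le hdD
  refine ⟨n, L, hLd, hLz, t, d, hn₀, hd0, by simpa only [one_mul] using hdD,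
    by simpa only [mul_one, one_mul, mul_comm] using hD2d, ?_, n, hn, by simp, w, hw, θ, hθt, hθx⟩
  intro u hu hu0
  have h1 : 2 * Real.sqrt n / Λ ≤ d := le_max_right _ _
  have h2 : 2 * Real.sqrt n / d ≤ Λ := by
    rw [div_le_iff₀ hd0]
    calc 2 * Real.sqrt n = 2 * Real.sqrt n / Λ * Λ := by field_simp
      _ ≤ d * Λ := by gcongr
      _ = Λ * d := mul_comm _ _
  exact h2.trans (hdual u hu hu0)

end Summit.PneNP.PneNP.Theorems.LatticeMagicMagicFunctionsPersist

/-- The crux `MagicFunctionsPersist` of route LatticeMagic (item stmt-PneNP-2328), as typed. -/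
theorem Summit.PneNP.PneNP.Theorems.magicFunctionsPersist_proof :
    Summit.PneNP.PneNP.Theses.LatticeMagic.MagicFunctionsPersist :=
  Summit.PneNP.PneNP.Theorems.LatticeMagicMagicFunctionsPersist.MagicFunctionsPersist_of

end
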